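import Summits.Ventures.CertifiedManyBodySolver.Observables.CanonicalFloorW5Continuum
import Summits.Ventures.CertifiedManyBodySolver.Observables.CanonicalFloorTPrimePlaneContinuum
import Summits.Ventures.CertifiedManyBodySolver.Certificates.HubbardSquare_n7o8_sourced_openbox32x4_k3o7_mu7o4_D1000_j264564
import Summits.Ventures.CertifiedManyBodySolver.Certificates.HubbardSquare_n7o8_pinning_capTP_twoFieldDoccDiagHop_nodes_g3o14_g1o4_g2o7
import Summits.Ventures.CertifiedManyBodySolver.Certificates.HubbardSquare_n7o8_lower_row505
import HarnessLib

/-!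
# t′ = 0 canonical (density 7/8, U = 8) pinning-field response floor AT THE SINGLE FIELD `g = 3/14` (`h_tree ≈ 0.30305`) from the
# W5-CERTIFIED PLAIN κ 3/7 node `cert_sgf_openbox32x4_U8_mu7o4_k3o7_j264564` (CERTIFIED #562) ⊕ the x2dk vector `cert_capTPx2dk_4x3_U8_tpm1o4_g3o14_mu5o2`
# transported to `t′ = 0`, against `#505`: **0.0965156 ≤ Re ω(P₀^d)** (cell of record 0.0921227)

Cell hubbard-cq (rung CQ, CQ-TABLE l.23 canonical t′ = 0 ladder, cell 0.30305; row «h-chord transport nodes», seat hubbard-cq-obsth-2 g21, 2026-08-28).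
WHY: the t′ = 0 cell word of record at 0.30305 is cq-p2's 0.0921227 (`canonicalChordFloor_U8_n7o8_tp0_g3o14_W32x4_r505_of_nodes`, PLAIN κ 3/7 node ⊕ the
native 4 × 3 cap `cert_capU2_4x3_U8_tp0_g3o14_mu9o4`); the κ 3/7 LINE words through 0.30305 (0.0965156 in `CanonicalFloorW32K3o7ContinuumTP.lean`, p494451)
are CANDIDATE because they take the κ 3/7 TWO-FIELD node (zero-field rows = SET A re-read, r210). But AT the node's OWN field `g = κ/2 = 3/14` no field
transport is needed: the PLAIN five-conjunct node (parity, norm, energy at `(μ, h) = (7/4, (3/14)·√2)`, density window) suffices, and the x2dk partner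
`…_g3o14_mu5o2` is native at the same field (moved only in t′, `−1/4 → 0`, by its point k₂ row: `clusterCapTT'_tp_point_vol` + `dWaveSourceOpenBoxTT'_zero_tp`).
Exact partner scan at g = 3/14 over the 35 refereed x2dk vectors (this seat, stdlib `Fraction`): g3o14 μ5/2 0.0965156 · g1o4 μ5/2 0.0950757 · g3o14 μ9/4
0.0948610 · g2o7 μ5/2 0.0921591 (all transported to t′ = 0). Mixture `exists_canonicalClass_sourced_le_of_clusterCapInterval_of_clusterCap` (worst end of the
W5 density window; cap constant `C = -0.8905189074` = the worst-end mixture rounded UP to 1e-10), floor `re_expect_localPairAt_ge_of_minimiser` on `#505`: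
`(ℓ₅₀₅ − C)/(2·√2·3/14) ≤ Re ω(P₀^d)`, margin `ℓ₅₀₅ − C = +0.058497334`, decimal 7 dp DOWN `0.0965156` (`le_chord_of_decimal_bound`, `√2 < 1.4142135624`;
two arithmetics: Fraction + Decimal-50). Premise class: `#505` CERTIFIED · PLAIN κ 3/7 node W5-CERTIFIED (#562, sr-mbsolver; the class-A premise of the
0.0921227 word) · x2dk cap refereed (XC1-TPCAP 35/35; k₂ W14b/W14c; cq RULING 378 (3)). No new claim node.

HONEST FRAMING: a large-field finite-h RESPONSE floor (h_p = 4·h_tree ≈ 1.21) for translation-invariant density-⅞ minimisers of E^{t′=0}_{√2·3/14} at U = 8,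
CONDITIONAL by name on the three nodes; never an order parameter; nothing about `h → 0`; no phase sentence; superconductivity in the Hubbard model is NOT
proved or disproved by any of this. Zero compute; no definition; no named fact; no `sorry`.
References: R. B. Griffiths, Phys. Rev. 152 (1966) 240 §II; D. Ruelle, *Statistical Mechanics* (1969) §3.3–3.4.
-/

noncomputable section

namespace Summit.Ventures.CertifiedManyBodySolver.Observables

open Matrix Finset Literature.Probability.LatticeModels
open Literature.MathematicalPhysics.QuantumLattice Literature.MathematicalPhysics.QuantumLattice.ThermodynamicLimit
open Literature.MathematicalPhysics.QuantumLattice.TwoCluster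
open Summit.Ventures.CertifiedManyBodySolver.Certificates
open scoped ComplexOrder

variable {ω : InfVolFermionState 2}

/-- **t′ = 0 CANONICAL FLOOR AT g = 3/14 from the PLAIN κ 3/7 node (its own field) ⊕ the x2dk `g3o14 μ5/2` vector moved to t′ = 0.** For every
translation-invariant density-`7/8` minimiser `ω` of `E_{√2·3/14}`: `(ℓ₅₀₅ − C)/(2·(√2·3/14)) ≤ Re ω(P₀^d)`, `C = -0.8905189074` (exact rational, worst end of
the W5 density window, rounded up to 1e-10). CONDITIONAL on the three nodes; a finite-field RESPONSE floor. [cite: Griffiths1966, §II] [cite: Ruelle1969, §3.4] -/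
theorem canonicalFloor_n7o8_tp0_g3o14_W32k3o7plain_x3o14mu5o2 (hω : ω.IsTranslationInvariant) (hρ : ω.density = 7 / 8)
    (hmin : ∀ ω' : InfVolFermionState 2, ω'.IsTranslationInvariant → ω'.density = 7 / 8 →
      ω.meanEnergy (hubbardTTPrimeSourcedInteraction 1 0 8 0 dWaveFormFactor (Real.sqrt 2 * (3 / 14 : ℝ))) 1 ≤
        ω'.meanEnergy (hubbardTTPrimeSourcedInteraction 1 0 8 0 dWaveFormFactor (Real.sqrt 2 * (3 / 14 : ℝ))) 1)
    (hfl : cert_r505_HYB_GU8n7o8eom8_w3_b4_R2_ob5p2_kry1_kry2c3rel_menulite_core_focert_it2000)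
    (hW : cert_sgf_openbox32x4_U8_mu7o4_k3o7_j264564) (hC : cert_capTPx2dk_4x3_U8_tpm1o4_g3o14_mu5o2) :
    ((((-1005852362687652330064247 / 1208925819614629174706176 : ℚ)) : ℝ) - (((-4452594537 / 5000000000 : ℚ)) : ℝ)) / (2 * (Real.sqrt 2 * (3 / 14 : ℝ))) ≤
      (ω.expect (pairRegion (insert 0 unitSteps) 0) (localPairAt (insert 0 unitSteps) dWaveFormFactor 0)).re := by
  obtain ⟨ψ₁, hp₁, h1₁, hE₁, hNlo₁, hNhi₁⟩ := hW
  obtain ⟨ψ₂, hp₂, h1₂, hE₂, hNlo₂, hNhi₂, -, -, -, -, hKlo₂, hKhi₂⟩ := hC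
  have hfield : ((3 : ℝ) / 14) * Real.sqrt 2 = Real.sqrt 2 * (3 / 14 : ℝ) := by ring
  rw [hfield] at hE₁
  have hcap₂ := clusterCapTT'_tp_point_vol (tp' := (0 : ℝ)) hE₂ hKlo₂ hKhi₂
  rw [dWaveSourceOpenBoxTT'_zero_tp] at hcap₂
  have hN₂ : (star ψ₂ ⬝ᵥ (totalNumber *ᵥ ψ₂)).re = ((((1116776562797982920 / 1152921504269946417 : ℚ))) : ℝ) * (((4 : ℕ) : ℝ) * (3 : ℕ)) := by
    push_cast at hNlo₂ hNhi₂ ⊢; linarith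
  have hE₁' : (star ψ₁ ⬝ᵥ (dWaveSourceOpenBox 32 4 8 ((7 : ℝ) / 4) (Real.sqrt 2 * (3 / 14 : ℝ)) *ᵥ ψ₁)).re ≤
      ((((-172248080227355 : ℚ) / 70368744177664) : ℚ) : ℝ) * (((32 : ℕ) : ℝ) * (4 : ℕ)) := by
    push_cast at hE₁ ⊢; linarith
  have hE₂' : (star ψ₂ ⬝ᵥ (dWaveSourceOpenBox 4 3 8 (5/2 : ℝ) (Real.sqrt 2 * (3 / 14 : ℝ)) *ᵥ ψ₂)).re ≤
      ((((-3194105993717112941 / 1052667460420385859 : ℚ))) : ℝ) * (((4 : ℕ) : ℝ) * (3 : ℕ)) := by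
    push_cast at hcap₂ ⊢; linarith
  refine re_expect_localPairAt_ge_of_minimiser hω (by norm_num) hρ (by norm_num) (by norm_num) (by positivity) hfl hmin ?_
  refine exists_canonicalClass_sourced_le_of_clusterCapInterval_of_clusterCap (by norm_num) (by norm_num) (by norm_num)
    (by norm_num) (8 : ℝ) ((7 : ℝ) / 4) (5/2 : ℝ) (Real.sqrt 2 * (3 / 14 : ℝ)) hp₁ h1₁ hp₂ h1₂ hNlo₁ hNhi₁ hE₁' hN₂ hE₂'
    (by norm_num) (by norm_num) ?_ ?_
  · push_cast; norm_num
  · push_cast; norm_num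

/-- **Cell word at `g = 3/14` (`h_tree ≈ 0.30305`): `0.0965156 ≤ Re ω(P₀^d)`** (margin `+0.0584973`; 7 dp down; cell of record 0.0921227). CONDITIONAL on
the three nodes; a finite-field RESPONSE floor; never order, no phase word. [cite: Griffiths1966, §II] -/
theorem canonicalFloor_n7o8_tp0_g3o14_W32k3o7plain_x3o14mu5o2_decimal (hω : ω.IsTranslationInvariant) (hρ : ω.density = 7 / 8)
    (hmin : ∀ ω' : InfVolFermionState 2, ω'.IsTranslationInvariant → ω'.density = 7 / 8 →
      ω.meanEnergy (hubbardTTPrimeSourcedInteraction 1 0 8 0 dWaveFormFactor (Real.sqrt 2 * (3 / 14 : ℝ))) 1 ≤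
        ω'.meanEnergy (hubbardTTPrimeSourcedInteraction 1 0 8 0 dWaveFormFactor (Real.sqrt 2 * (3 / 14 : ℝ))) 1)
    (hfl : cert_r505_HYB_GU8n7o8eom8_w3_b4_R2_ob5p2_kry1_kry2c3rel_menulite_core_focert_it2000)
    (hW : cert_sgf_openbox32x4_U8_mu7o4_k3o7_j264564) (hC : cert_capTPx2dk_4x3_U8_tpm1o4_g3o14_mu5o2) :
    (0.0965156 : ℝ) ≤
      (ω.expect (pairRegion (insert 0 unitSteps) 0) (localPairAt (insert 0 unitSteps) dWaveFormFactor 0)).re :=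
  (le_chord_of_decimal_bound (by norm_num) (by norm_num) (by push_cast; norm_num)).trans
    (canonicalFloor_n7o8_tp0_g3o14_W32k3o7plain_x3o14mu5o2 hω hρ hmin hfl hW hC)

end Summit.Ventures.CertifiedManyBodySolver.Observables

end
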